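import Mathlib
import HarnessLib
import Summits.NavierStokesRegularity.FluidComputer.TriggeredTransferDataZoom
import Summits.NavierStokesRegularity.NavierStokesRegularity.Theorems.AdiabaticEddyClayUniquenessCore
import Literature.Analysis.FluidPDE.NSUnconditionalUniquenessHolds

/-!
# Fluid computer, door N1-FC — ZOOMED PIECES of a triggered transfer and the UNFORCED JUNCTION: the toolkit a cascade-gluing proof consumes

Cell `ns-blowup`, seat `ns-blowup-fc-prover-2` (D-0074 GROUP C «bridge support»); companion of
`TriggeredTransfer.lean` (door vocabulary, seat `ns-blowup-fc-route`), `TriggeredTransferDataZoom.lean`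
(this seat) and of the cascade-gluing files of seat `ns-blowup-fc-prover-1` (`CascadeGluing :
TriggerScheme.Transfers ν → Nonempty (BreakdownWitness ν)`, in preparation). LABEL: E–C bookkeeping.
WHAT THIS IS NOT: not Navier–Stokes evidence — change-of-variables bookkeeping for classical solutions
and ONE application of a uniqueness THEOREM of the tree; no scheme, flow or blow-up is asserted.

A triggered transfer (`TriggerScheme.Step`) delivers, on the level's own clock and at unit scale, an
exact classical solution `(u, p)` of the system forced by a trigger `g` on `[0, T + δ]`, whose slice
`u T` is the `λ`-zoom of the next level's initial state. Gluing the levels into ONE solution needs: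

* **the zoomed piece** (§1): `zoomSol c t₀ a u = (t, x) ↦ c • u (c² (t - t₀)) (c • (x - a))`, with
  `zoomPressure` (`c²`) and `zoomForce` (`c³`), is a classical solution on the physical slab
  `[t₀, t₀ + S/c²]` whenever `(u, p)` is one on `[0, S]` (`isClassicalNSSolutionOn_zoomPiece` — the
  case `α = γ = c`, `β = c²`, `t₀ ↦ -c² t₀`, `x₀ ↦ -c • a` of the tree's
  `IsClassicalNSSolutionOn.nsRescale_translate` [cite: Leray1934, §20]); its slices are `zoom`s of the
  unit-scale slices (`zoomSol_slice`), so finite energy and the Clay clauses pass through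
  (`TriggeredTransferDataZoom`);
* **the zoomed trigger** (§2): `zoomForce c t₀ a g` is smooth on `ℝ × ℝ³`, vanishes before
  `t₀ + δ/c²`, after `t₀ + T/c²` and outside `B̄(a, R/c)`, and
  `‖Dⁱ (zoomForce c t₀ a g)‖ ≤ c³ (c²)ⁱ · sup ‖Dⁱ g‖` for `c ≥ 1` (chain rule through the space–time
  dilation `L(t, x) = (c² t, c x)`, `‖L‖ ≤ c²`) — the per-level input of
  `PalasekTowerForceBudget.clayForce_of_summable_levels` [cite: FeffermanClay2006, (C) (5)];
* **the unforced junction** (§3): two classical finite-energy solutions on a window `[t₁, t₂]`,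
  `ν > 0`, whose forces VANISH on the window and which share a smooth rapidly decaying slice at `t₁`,
  coincide on the window (`eq_on_unforced_window`) — by the tree THEOREM
  `Literature.Analysis.FluidPDE.tao_unconditional_uniqueness_velocity_holds` (Tao 2013, Cor. 11.4,
  unforced, DISCHARGED) after a time shift; the trigger of level `n` is off from its hand-over time on
  (`IsTrigger.off_late`) and the zoomed trigger of level `n+1` is off until `δ_{n+1}/λ²` after it
  (`off_early`), so every junction of the cascade is such a window and NO forced-uniqueness named fact
  (W14) is needed [cite: Tao2011, Cor. 11.4].

0 sorry; axioms ⊆ {propext, Classical.choice, Quot.sound}.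
-/

noncomputable section

namespace Summit.NavierStokesRegularity.FluidComputer.TriggeredTransfer

open Set MeasureTheory Function Module
open scoped ENNReal ContDiff NNReal
open Literature.Analysis.FluidPDE
open Literature.Analysis.FluidPDE.FluidComputer (E3 Vel)
open Summit.NavierStokesRegularity.NavierStokesRegularity.Theorems

/-! ## §1 The zoomed piece -/

/-- The zoomed velocity: `(t, x) ↦ c • u (c² (t - t₀)) (c • (x - a))` (parabolic scaling by `c` at
fixed viscosity, started at physical time `t₀` and centred at `a`). [cite: Leray1934, §20] -/
def zoomSol (c t₀ : ℝ) (a : E3) (u : ℝ → Vel) : ℝ → Vel :=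
  fun t x => c • u (c ^ 2 * (t - t₀)) (c • (x - a))

/-- The zoomed pressure: `(t, x) ↦ c² • p (c² (t - t₀)) (c • (x - a))`. [cite: Leray1934, §20] -/
def zoomPressure (c t₀ : ℝ) (a : E3) (p : ℝ → E3 → ℝ) : ℝ → E3 → ℝ :=
  fun t x => c ^ 2 • p (c ^ 2 * (t - t₀)) (c • (x - a))

/-- The zoomed force: `(t, x) ↦ c³ • g (c² (t - t₀)) (c • (x - a))`. [cite: Leray1934, §20] -/
def zoomForce (c t₀ : ℝ) (a : E3) (g : ℝ → Vel) : ℝ → Vel :=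
  fun t x => c ^ 3 • g (c ^ 2 * (t - t₀)) (c • (x - a))

/-- Unfolding `zoomSol`. [folklore] -/
@[simp] theorem zoomSol_apply (c t₀ : ℝ) (a : E3) (u : ℝ → Vel) (t : ℝ) (x : E3) :
    zoomSol c t₀ a u t x = c • u (c ^ 2 * (t - t₀)) (c • (x - a)) := rfl

/-- Unfolding `zoomPressure`. [folklore] -/
@[simp] theorem zoomPressure_apply (c t₀ : ℝ) (a : E3) (p : ℝ → E3 → ℝ) (t : ℝ) (x : E3) :
    zoomPressure c t₀ a p t x = c ^ 2 • p (c ^ 2 * (t - t₀)) (c • (x - a)) := rfl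

/-- Unfolding `zoomForce`. [folklore] -/
@[simp] theorem zoomForce_apply (c t₀ : ℝ) (a : E3) (g : ℝ → Vel) (t : ℝ) (x : E3) :
    zoomForce c t₀ a g t x = c ^ 3 • g (c ^ 2 * (t - t₀)) (c • (x - a)) := rfl

/-- Slices of the zoomed velocity are zooms of the unit-scale slices:
`zoomSol c t₀ a u t = zoom c a (u (c² (t - t₀)))`. [folklore] -/
theorem zoomSol_slice (c t₀ : ℝ) (a : E3) (u : ℝ → Vel) (t : ℝ) :
    zoomSol c t₀ a u t = zoom c a (u (c ^ 2 * (t - t₀))) := rfl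

/-- The initial slice of the zoomed velocity: `zoomSol c t₀ a u t₀ = zoom c a (u 0)`. [folklore] -/
theorem zoomSol_initial (c t₀ : ℝ) (a : E3) (u : ℝ → Vel) :
    zoomSol c t₀ a u t₀ = zoom c a (u 0) := by
  rw [zoomSol_slice, sub_self, mul_zero]

/-- The slice at physical time `t₀ + T / c²` is the zoom of the unit-scale slice at `T` (`c ≠ 0`).
[folklore] -/
theorem zoomSol_handover {c : ℝ} (hc : c ≠ 0) (t₀ T : ℝ) (a : E3) (u : ℝ → Vel) :
    zoomSol c t₀ a u (t₀ + T / c ^ 2) = zoom c a (u T) := by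
  rw [zoomSol_slice, add_sub_cancel_left, mul_div_cancel₀ _ (pow_ne_zero 2 hc)]

/-- `zoomSol` in the tree's `stPull` vocabulary. [folklore] -/
theorem zoomSol_eq_stPull (c t₀ : ℝ) (a : E3) (u : ℝ → Vel) :
    zoomSol c t₀ a u = c • stPull (c ^ 2) c (-(c ^ 2 * t₀)) (-(c • a)) u := by
  funext t x
  simp only [zoomSol_apply, Pi.smul_apply, stPull_apply, smul_sub, mul_sub, neg_add_eq_sub]

/-- `zoomPressure` in the tree's `stPull` vocabulary. [folklore] -/
theorem zoomPressure_eq_stPull (c t₀ : ℝ) (a : E3) (p : ℝ → E3 → ℝ) :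
    zoomPressure c t₀ a p = c ^ 2 • stPull (c ^ 2) c (-(c ^ 2 * t₀)) (-(c • a)) p := by
  funext t x
  simp only [zoomPressure_apply, Pi.smul_apply, stPull_apply, smul_sub, mul_sub, neg_add_eq_sub]

/-- `zoomForce` in the tree's `stPull` vocabulary. [folklore] -/
theorem zoomForce_eq_stPull (c t₀ : ℝ) (a : E3) (g : ℝ → Vel) :
    zoomForce c t₀ a g = (c ^ 2 * c) • stPull (c ^ 2) c (-(c ^ 2 * t₀)) (-(c • a)) g := by
  funext t x
  simp only [zoomForce_apply, Pi.smul_apply, stPull_apply, smul_sub, mul_sub, neg_add_eq_sub]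
  rw [show c ^ 2 * c = c ^ 3 by ring]

/-- The physical slab of a zoomed piece: `{t | c² (t - t₀) ∈ [0, S]} = [t₀, t₀ + S / c²]` (`c ≠ 0`).
[folklore] -/
theorem preimage_zoom_time {c : ℝ} (hc : c ≠ 0) (t₀ S : ℝ) :
    (fun r => -(c ^ 2 * t₀) + c ^ 2 * r) ⁻¹' Icc 0 S = Icc t₀ (t₀ + S / c ^ 2) := by
  have hc2 : 0 < c ^ 2 := by positivity
  ext r
  simp only [mem_preimage, mem_Icc]
  have e : -(c ^ 2 * t₀) + c ^ 2 * r = c ^ 2 * (r - t₀) := by ring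
  rw [e]
  constructor
  · rintro ⟨h1, h2⟩
    have h3 : r - t₀ ≤ S / c ^ 2 := (le_div_iff₀ hc2).2 (by linarith)
    constructor
    · nlinarith
    · linarith
  · rintro ⟨h1, h2⟩
    have h3 : (r - t₀) * c ^ 2 ≤ S := (le_div_iff₀ hc2).1 (by linarith)
    exact ⟨mul_nonneg hc2.le (by linarith), by linarith⟩

/-- Membership form of `preimage_zoom_time`: physical times in `[t₀, t₀ + S / c²]` have level clock
`c² (t - t₀) ∈ [0, S]` (`c ≠ 0`). [folklore] -/
theorem clock_mem_Icc {c : ℝ} (hc : c ≠ 0) {t₀ S t : ℝ} (ht : t ∈ Icc t₀ (t₀ + S / c ^ 2)) :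
    c ^ 2 * (t - t₀) ∈ Icc 0 S := by
  have h : t ∈ (fun r => -(c ^ 2 * t₀) + c ^ 2 * r) ⁻¹' Icc 0 S := by
    rw [preimage_zoom_time hc]; exact ht
  have e : -(c ^ 2 * t₀) + c ^ 2 * t = c ^ 2 * (t - t₀) := by ring
  simpa [e] using h

/-- **The zoomed piece is a classical solution on the physical slab.** If `(u, p)` solves the system
forced by `g` classically on `[0, S]` (unit scale, own clock), then for `c > 0` the zoomed triple
`(zoomForce, zoomSol, zoomPressure) c t₀ a (g, u, p)` solves it with the SAME viscosity on
`[t₀, t₀ + S / c²]` (Leray's similarity followed by a space–time translation; the tree's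
`IsClassicalNSSolutionOn.nsRescale_translate`). [cite: Leray1934, §20] -/
theorem isClassicalNSSolutionOn_zoomPiece {ν S : ℝ}
    {g u : ℝ → Vel} {p : ℝ → E3 → ℝ} (h : IsClassicalNSSolutionOn (Icc 0 S) ν g u p)
    {c : ℝ} (hc : 0 < c) (t₀ : ℝ) (a : E3) :
    IsClassicalNSSolutionOn (Icc t₀ (t₀ + S / c ^ 2)) ν (zoomForce c t₀ a g) (zoomSol c t₀ a u)
      (zoomPressure c t₀ a p) := by
  have key := h.nsRescale_translate hc (-(c ^ 2 * t₀)) (-(c • a))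
  rw [preimage_zoom_time hc.ne', ← zoomForce_eq_stPull, ← zoomSol_eq_stPull,
    ← zoomPressure_eq_stPull] at key
  exact key

/-- Energy of a zoomed slice: `∫⁻ ‖zoomSol c t₀ a u t‖ₑ² = c² (c³)⁻¹ ∫⁻ ‖u (c² (t - t₀))‖ₑ²`; in
particular a finite energy bound on the unit-scale slab gives one on the physical slab. [folklore] -/
theorem lintegral_enorm_sq_zoomSol {c : ℝ} (hc : 0 < c) (t₀ : ℝ) (a : E3) (u : ℝ → Vel) (t : ℝ) :
    ∫⁻ x, ‖zoomSol c t₀ a u t x‖ₑ ^ 2 =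
      ENNReal.ofReal (c ^ 2) * ENNReal.ofReal (c ^ 3)⁻¹ * ∫⁻ x, ‖u (c ^ 2 * (t - t₀)) x‖ₑ ^ 2 := by
  rw [zoomSol_slice]
  exact lintegral_enorm_sq_zoom hc a _

/-- Finite energy passes to the zoomed piece: a bound `C < ∞` on `[0, S]` gives the bound
`c² (c³)⁻¹ C < ∞` on `[t₀, t₀ + S / c²]`. [folklore] -/
theorem energy_zoomSol {c : ℝ} (hc : 0 < c) (t₀ S : ℝ) (a : E3) {u : ℝ → Vel}
    (hE : ∃ C : ℝ≥0∞, C < ⊤ ∧ ∀ s ∈ Icc 0 S, ∫⁻ x, ‖u s x‖ₑ ^ 2 ≤ C) :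
    ∃ C : ℝ≥0∞, C < ⊤ ∧ ∀ t ∈ Icc t₀ (t₀ + S / c ^ 2), ∫⁻ x, ‖zoomSol c t₀ a u t x‖ₑ ^ 2 ≤ C := by
  obtain ⟨C, hC, hb⟩ := hE
  refine ⟨ENNReal.ofReal (c ^ 2) * ENNReal.ofReal (c ^ 3)⁻¹ * C,
    ENNReal.mul_lt_top (ENNReal.mul_lt_top ENNReal.ofReal_lt_top ENNReal.ofReal_lt_top) hC,
    fun t ht => ?_⟩
  rw [lintegral_enorm_sq_zoomSol hc]
  have hmem : c ^ 2 * (t - t₀) ∈ Icc 0 S := clock_mem_Icc hc.ne' ht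
  gcongr
  exact hb _ hmem

/-! ## §2 The zoomed trigger -/

/-- The space–time dilation `L(t, x) = (c² t, c x)` as a continuous linear map. [folklore] -/
def stDilation (c : ℝ) : ℝ × E3 →L[ℝ] ℝ × E3 :=
  (c ^ 2 • ContinuousLinearMap.fst ℝ ℝ E3).prod (c • ContinuousLinearMap.snd ℝ ℝ E3)

/-- Unfolding `stDilation`. [folklore] -/
@[simp] theorem stDilation_apply (c : ℝ) (z : ℝ × E3) :
    stDilation c z = (c ^ 2 * z.1, c • z.2) := by
  simp [stDilation]

/-- `‖L‖ ≤ c²` for `c ≥ 1` (sup norm on `ℝ × ℝ³`; `c ≤ c²`). [folklore] -/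
theorem norm_stDilation_le {c : ℝ} (hc : 1 ≤ c) : ‖stDilation c‖ ≤ c ^ 2 := by
  have hc0 : 0 ≤ c := zero_le_one.trans hc
  have hcc : c ≤ c ^ 2 := by nlinarith
  refine ContinuousLinearMap.opNorm_le_bound _ (by positivity) fun z => ?_
  rw [stDilation_apply, Prod.norm_def, Prod.norm_def, mul_max_of_nonneg _ _ (by positivity : 0 ≤ c ^ 2)]
  refine max_le_max ?_ ?_
  · rw [norm_mul, Real.norm_of_nonneg (by positivity : 0 ≤ c ^ 2)]
  · rw [norm_smul, Real.norm_of_nonneg hc0]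
    exact mul_le_mul_of_nonneg_right hcc (norm_nonneg _)

/-- The uncurried zoomed force as `c³ • ((uncurry g ∘ L) ∘ (· - (t₀, a)))`. [folklore] -/
theorem uncurry_zoomForce (c t₀ : ℝ) (a : E3) (g : ℝ → Vel) :
    uncurry (zoomForce c t₀ a g) =
      c ^ 3 • fun z : ℝ × E3 => (uncurry g ∘ stDilation c) (z - (t₀, a)) := by
  funext z
  obtain ⟨t, x⟩ := z
  simp [zoomForce, mul_sub, smul_sub]

/-- The zoomed force of a smooth force is smooth on all of `ℝ × ℝ³`. [folklore] -/
theorem contDiff_uncurry_zoomForce {g : ℝ → Vel} (hg : ContDiff ℝ ∞ (uncurry g)) (c t₀ : ℝ)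
    (a : E3) : ContDiff ℝ ∞ (uncurry (zoomForce c t₀ a g)) := by
  rw [uncurry_zoomForce]
  exact ((hg.comp (stDilation c).contDiff).comp (contDiff_id.sub contDiff_const)).const_smul (c ^ 3)

/-- **Derivative bound for the zoomed force**: `‖Dⁱ (zoomForce c t₀ a g)‖ ≤ c³ (c²)ⁱ B` whenever
`‖Dⁱ g‖ ≤ B` everywhere and `c ≥ 1` (chain rule through the dilation `L`, `‖L‖ ≤ c²`, and the
translation). With `c = λⁿ` and `B = ε_n A_i` this is the super-exponentially summable ledger that
`clayForce_of_summable_levels` asks for. [cite: FeffermanClay2006, (C) (5)] -/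
theorem norm_iteratedFDeriv_zoomForce_le {g : ℝ → Vel} (hg : ContDiff ℝ ∞ (uncurry g)) {c : ℝ}
    (hc : 1 ≤ c) (t₀ : ℝ) (a : E3) {i : ℕ} {B : ℝ}
    (hB : ∀ z, ‖iteratedFDeriv ℝ i (uncurry g) z‖ ≤ B) (z : ℝ × E3) :
    ‖iteratedFDeriv ℝ i (uncurry (zoomForce c t₀ a g)) z‖ ≤ c ^ 3 * (c ^ 2) ^ i * B := by
  have hc0 : 0 < c := lt_of_lt_of_le one_pos hc
  set L := stDilation c with hL
  set G : ℝ × E3 → E3 := uncurry g ∘ (L : ℝ × E3 → ℝ × E3) with hG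
  have hgi : ContDiff ℝ i (uncurry g) := hg.of_le (by exact_mod_cast le_top)
  have hGi : ContDiff ℝ i G := hgi.comp L.contDiff
  have hGs : ContDiff ℝ i (fun w => G (w - (t₀, a))) := hGi.comp (contDiff_id.sub contDiff_const)
  have hB0 : 0 ≤ B := le_trans (norm_nonneg _) (hB 0)
  rw [uncurry_zoomForce, iteratedFDeriv_const_smul_apply hGs.contDiffAt, norm_smul, Real.norm_eq_abs,
    abs_of_pos (pow_pos hc0 3), iteratedFDeriv_comp_sub, hG, L.iteratedFDeriv_comp_right hgi _ le_rfl,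
    mul_assoc]
  refine mul_le_mul_of_nonneg_left ?_ (pow_pos hc0 3).le
  calc ‖(iteratedFDeriv ℝ i (uncurry g) (L (z - (t₀, a)))).compContinuousLinearMap fun _ => L‖
      ≤ ‖iteratedFDeriv ℝ i (uncurry g) (L (z - (t₀, a)))‖ * ∏ _j : Fin i, ‖L‖ :=
        ContinuousMultilinearMap.norm_compContinuousLinearMap_le _ _
    _ ≤ B * (c ^ 2) ^ i := by
        rw [Finset.prod_const, Finset.card_univ, Fintype.card_fin]
        exact mul_le_mul (hB _) (pow_le_pow_left₀ (norm_nonneg _) (norm_stDilation_le hc) i)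
          (by positivity) hB0
    _ = (c ^ 2) ^ i * B := mul_comm _ _

/-- The zoomed force is off BEFORE `t₀ + δ / c²` if the force is off before `δ` (`c ≠ 0`).
[folklore] -/
theorem zoomForce_eq_zero_of_le {g : ℝ → Vel} {δ : ℝ} (hoff : ∀ t, t ≤ δ → g t = 0) {c : ℝ}
    (hc : c ≠ 0) (t₀ : ℝ) (a : E3) {t : ℝ} (ht : t ≤ t₀ + δ / c ^ 2) : zoomForce c t₀ a g t = 0 := by
  have hc2 : 0 < c ^ 2 := by positivity
  have h1 : c ^ 2 * (t - t₀) ≤ δ := by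
    have := (le_div_iff₀ hc2).1 (by linarith : t - t₀ ≤ δ / c ^ 2)
    linarith
  funext x
  rw [zoomForce_apply, hoff _ h1]
  simp

/-- The zoomed force is off AFTER `t₀ + T / c²` if the force is off after `T` (`c ≠ 0`).
[folklore] -/
theorem zoomForce_eq_zero_of_ge {g : ℝ → Vel} {T : ℝ} (hoff : ∀ t, T ≤ t → g t = 0) {c : ℝ}
    (hc : c ≠ 0) (t₀ : ℝ) (a : E3) {t : ℝ} (ht : t₀ + T / c ^ 2 ≤ t) : zoomForce c t₀ a g t = 0 := by
  have hc2 : 0 < c ^ 2 := by positivity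
  have h1 : T ≤ c ^ 2 * (t - t₀) := by
    have := (div_le_iff₀ hc2).1 (by linarith : T / c ^ 2 ≤ t - t₀)
    linarith
  funext x
  rw [zoomForce_apply, hoff _ h1]
  simp

/-- The zoomed force vanishes outside the closed ball `B̄(a, R / c)` if the force vanishes outside
`B̄(0, R)` (`c > 0`). [folklore] -/
theorem zoomForce_apply_eq_zero_of_norm {g : ℝ → Vel} {R : ℝ}
    (hoff : ∀ (t : ℝ) (x : E3), R ≤ ‖x‖ → g t x = 0) {c : ℝ} (hc : 0 < c) (t₀ : ℝ) (a : E3)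
    (t : ℝ) {x : E3} (hx : R / c ≤ ‖x - a‖) : zoomForce c t₀ a g t x = 0 := by
  have h1 : R ≤ ‖c • (x - a)‖ := by
    rw [norm_smul, Real.norm_of_nonneg hc.le]
    have := (div_le_iff₀' hc).1 hx
    linarith
  rw [zoomForce_apply, hoff _ _ h1, smul_zero]

/-- The same with the support measured from the origin: off outside `B̄(0, ‖a‖ + R / c)`. [folklore] -/
theorem zoomForce_apply_eq_zero_of_norm' {g : ℝ → Vel} {R : ℝ}
    (hoff : ∀ (t : ℝ) (x : E3), R ≤ ‖x‖ → g t x = 0) {c : ℝ} (hc : 0 < c) (t₀ : ℝ) (a : E3)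
    (t : ℝ) {x : E3} (hx : ‖a‖ + R / c ≤ ‖x‖) : zoomForce c t₀ a g t x = 0 := by
  refine zoomForce_apply_eq_zero_of_norm hoff hc t₀ a t ?_
  have := norm_sub_norm_le x a
  linarith

namespace TriggerScheme

/-- **A trigger, zoomed** (the level-`n` trigger placed in physical space–time): for
`𝒮.IsTrigger ε δ T g`, `c ≥ 1`, the zoomed force `zoomForce c t₀ a g` is smooth on `ℝ × ℝ³`, off for
`t ≤ t₀ + δ/c²`, for `t ≥ t₀ + T/c²` and for `‖x‖ ≥ ‖a‖ + R/c`, with `‖Dⁱ‖ ≤ c³ (c²)ⁱ ε Aᵢ`.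
[cite: FeffermanClay2006, (C) (5)] -/
theorem IsTrigger.zoomForce {𝒮 : TriggerScheme} {ε δ T : ℝ} {g : ℝ → Vel}
    (hg : 𝒮.IsTrigger ε δ T g) {c : ℝ} (hc : 1 ≤ c) (t₀ : ℝ) (a : E3) :
    ContDiff ℝ ∞ (uncurry (zoomForce c t₀ a g)) ∧
      (∀ t, t ≤ t₀ + δ / c ^ 2 → zoomForce c t₀ a g t = 0) ∧
      (∀ t, t₀ + T / c ^ 2 ≤ t → zoomForce c t₀ a g t = 0) ∧
      (∀ (t : ℝ) (x : E3), ‖a‖ + 𝒮.R / c ≤ ‖x‖ → zoomForce c t₀ a g t x = 0) ∧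
      ∀ (i : ℕ) (z : ℝ × E3),
        ‖iteratedFDeriv ℝ i (uncurry (zoomForce c t₀ a g)) z‖ ≤ c ^ 3 * (c ^ 2) ^ i * (ε * 𝒮.A i) := by
  have hc0 : 0 < c := lt_of_lt_of_le one_pos hc
  exact ⟨contDiff_uncurry_zoomForce hg.smooth c t₀ a,
    fun t ht => zoomForce_eq_zero_of_le hg.off_early hc0.ne' t₀ a ht,
    fun t ht => zoomForce_eq_zero_of_ge hg.off_late hc0.ne' t₀ a ht,
    fun t x hx => zoomForce_apply_eq_zero_of_norm' hg.off_far hc0 t₀ a t hx,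
    fun i z => norm_iteratedFDeriv_zoomForce_le hg.smooth hc t₀ a (hg.small i) z⟩

end TriggerScheme

/-! ## §3 The unforced junction -/

/-- Changing the force to one that agrees with it on the time set keeps a classical solution a
classical solution (the momentum equation is pointwise in `t ∈ S`). [folklore] -/
theorem isClassicalNSSolutionOn_force_congr {S : Set ℝ} {ν : ℝ} {f f' u : ℝ → Vel} {p : ℝ → E3 → ℝ}
    (h : IsClassicalNSSolutionOn S ν f u p) (hf : ∀ t ∈ S, f t = f' t) :
    IsClassicalNSSolutionOn S ν f' u p where
  smooth_velocity := h.smooth_velocity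
  smooth_pressure := h.smooth_pressure
  momentum t ht x := by rw [← hf t ht]; exact h.momentum t ht x
  divFree := h.divFree

/-- A classical solution on `[t₁, t₂]`, shifted to start at `0`, is a classical solution on
`[0, t₂ - t₁]` (time translation, the tree's `IsClassicalNSSolutionOn.comp_add_right`). [folklore] -/
theorem isClassicalNSSolutionOn_shift_Icc {ν t₁ t₂ : ℝ} {f u : ℝ → Vel} {p : ℝ → E3 → ℝ}
    (h : IsClassicalNSSolutionOn (Icc t₁ t₂) ν f u p) (ht : t₁ < t₂) :
    IsClassicalNSSolutionOn (Icc 0 (t₂ - t₁)) ν (fun t => f (t + t₁)) (fun t => u (t + t₁))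
      (fun t => p (t + t₁)) :=
  (h.comp_add_right t₁).mono (fun s hs => ⟨by linarith [hs.1], by linarith [hs.2]⟩)
    (uniqueDiffOn_Icc (sub_pos.2 ht))

/-- **THE UNFORCED JUNCTION.** Let `ν > 0`, `t₁ < t₂`, and let `(u₁, p₁)`, `(u₂, p₂)` be classical
solutions on the window `[t₁, t₂]` whose forces `f₁`, `f₂` VANISH on the window, with finite energy
there, sharing the slice `u₁ t₁ = u₂ t₁`, a rapidly decaying datum (Fefferman (4)). Then `u₁ = u₂` on
`[t₁, t₂]`. Proof: shift both to `[0, t₂ - t₁]`, replace the forces by `0`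
(`isClassicalNSSolutionOn_force_congr`), note the common datum is `H¹`
(`ClayUniqueness.memLp_two_of_rapidDecay`), and apply Tao's unconditional uniqueness, UNFORCED velocity
form — a THEOREM of the tree (`tao_unconditional_uniqueness_velocity_holds`). This is the step that
identifies consecutive levels of a triggered cascade on their overlap. [cite: Tao2011, Cor. 11.4] -/
theorem eq_on_unforced_window {ν t₁ t₂ : ℝ} (hν : 0 < ν) (ht : t₁ < t₂)
    {f₁ f₂ u₁ u₂ : ℝ → Vel} {p₁ p₂ : ℝ → E3 → ℝ}
    (h₁ : IsClassicalNSSolutionOn (Icc t₁ t₂) ν f₁ u₁ p₁)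
    (h₂ : IsClassicalNSSolutionOn (Icc t₁ t₂) ν f₂ u₂ p₂)
    (hf₁ : ∀ t ∈ Icc t₁ t₂, f₁ t = 0) (hf₂ : ∀ t ∈ Icc t₁ t₂, f₂ t = 0)
    (h0 : u₁ t₁ = u₂ t₁) (hdec : HasRapidSpatialDecay (u₁ t₁))
    (hE₁ : ∃ C : ℝ≥0∞, C < ⊤ ∧ ∀ t ∈ Icc t₁ t₂, ∫⁻ x, ‖u₁ t x‖ₑ ^ 2 ≤ C)
    (hE₂ : ∃ C : ℝ≥0∞, C < ⊤ ∧ ∀ t ∈ Icc t₁ t₂, ∫⁻ x, ‖u₂ t x‖ₑ ^ 2 ≤ C) :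
    ∀ t ∈ Icc t₁ t₂, u₁ t = u₂ t := by
  have hT : 0 < t₂ - t₁ := sub_pos.2 ht
  -- shift to `[0, t₂ - t₁]` and kill the forces
  have hs₁ : IsClassicalNSSolutionOn (Icc 0 (t₂ - t₁)) ν 0 (fun t => u₁ (t + t₁))
      (fun t => p₁ (t + t₁)) :=
    isClassicalNSSolutionOn_force_congr (isClassicalNSSolutionOn_shift_Icc h₁ ht)
      fun s hs => hf₁ (s + t₁) ⟨by linarith [hs.1], by linarith [hs.2]⟩
  have hs₂ : IsClassicalNSSolutionOn (Icc 0 (t₂ - t₁)) ν 0 (fun t => u₂ (t + t₁))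
      (fun t => p₂ (t + t₁)) :=
    isClassicalNSSolutionOn_force_congr (isClassicalNSSolutionOn_shift_Icc h₂ ht)
      fun s hs => hf₂ (s + t₁) ⟨by linarith [hs.1], by linarith [hs.2]⟩
  -- the common datum is `H¹`
  have hC1 : ContDiff ℝ 1 (u₁ t₁) :=
    (h₁.contDiff_velocity (t := t₁) ⟨le_rfl, ht.le⟩).of_le (by norm_cast)
  obtain ⟨hL2, hH1⟩ := ClayUniqueness.memLp_two_of_rapidDecay hdec hC1
  -- energies on the shifted window
  have hE₁' : ∃ C : ℝ≥0∞, C < ⊤ ∧ ∀ s ∈ Icc 0 (t₂ - t₁), ∫⁻ x, ‖u₁ (s + t₁) x‖ₑ ^ 2 ≤ C := by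
    obtain ⟨C, hC, hb⟩ := hE₁
    exact ⟨C, hC, fun s hs => hb (s + t₁) ⟨by linarith [hs.1], by linarith [hs.2]⟩⟩
  have hE₂' : ∃ C : ℝ≥0∞, C < ⊤ ∧ ∀ s ∈ Icc 0 (t₂ - t₁), ∫⁻ x, ‖u₂ (s + t₁) x‖ₑ ^ 2 ≤ C := by
    obtain ⟨C, hC, hb⟩ := hE₂
    exact ⟨C, hC, fun s hs => hb (s + t₁) ⟨by linarith [hs.1], by linarith [hs.2]⟩⟩
  have key := tao_unconditional_uniqueness_velocity_holds ν (t₂ - t₁) hν hT (u₁ t₁) hL2 hH1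
    (fun t => u₁ (t + t₁)) (fun t => u₂ (t + t₁)) (fun t => p₁ (t + t₁)) (fun t => p₂ (t + t₁))
    hs₁ hs₂ (by simp) (by simp [h0]) hE₁' hE₂'
  intro t htI
  have := key (t - t₁) ⟨by linarith [htI.1], by linarith [htI.2]⟩
  simpa using this

end Summit.NavierStokesRegularity.FluidComputer.TriggeredTransfer

end
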